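import Summits.CriticalPhenomena.PercolationContinuityZ3.Theorems.PercNearOneGluingNoHeavyQuantFarBundleReweight
import HarnessLib

/-!
# QUANT lane R8, front "FAR beyond trees", layer one — the BUNDLE DICHOTOMY at graph level: the layer-one FAR conclusion
# transfers from the DETACHED configuration

builds on p205010 (kernel theorem, internal audit signed; external expert review pending)

Support file (`--supports stmt-CriticalPhenomena-4575`), seat `prim-quant-p1` (gen 18); memo
`run/shared/lean/prim/quant/prim-quant-p1-g18/FOR-LEAD-UNICYCLIC-TREES.md` §2–§3 (kernel plan §6, file F-B part 4b).
Standard axioms; no sorries; no definitions.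

**Setting.**  `w : Sym2 (Fin n) → [0,1]`, observer `o`, relay set `A ⊇ Lf ∌ u`, a pocket `Bundle.IsPocket o p u ℓ₁ Lf` (bundle vertex `u ∉ A ∪ {o}`,
its pendant relays `Lf` (one or more), parent `p`), `w` vanishing on every non-allowed pair at `Z = insert u Lf` and on `s(p,ℓ₁)` (the CURRENT
bundle), heaviest leaf `ℓ₁`: `0 < w s(u,ℓ₁)` and `w s(u,ℓ) ≤ w s(u,ℓ₁)` for `ℓ ∈ Lf`; `wDet`, `wGlue` from `…QuantFarBundleReweight`.
* `Bundle.real_openConn_wDet_eq`, `Bundle.real_openConn_wGlue_eq` — every relay marginal `P(o ↔ a)`, `a ∈ A`, is preserved.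
* `Bundle.real_two_le_wDet_le_or_wGlue_le` — **the dichotomy at graph level**: `P_wDet(N ≥ 2) ≤ P_w(N ≥ 2)` or `P_wGlue(N ≥ 2) ≤ P_w(N ≥ 2)`
  (decomposition (D) of part II for the three weight functions, the pocket probabilities of part III = `Bundle.hCur/…/tGlue`, and the
  algebraic `Bundle.dichotomy`).
* `Bundle.real_openConn_le_two_le_wGlue` — exit: `P_wGlue(o ↔ ℓ₂) ≤ P_wGlue(N ≥ 2)` for every other leaf `ℓ₂`.
* **`Bundle.real_card_le_one_le_of_wDet`** — THE TRANSFER: if `P_w(o ↮ a) ≤ t` on `A` and `P_wDet(N ≤ 1) ≤ t`, then `P_w(N ≤ 1) ≤ t`.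
  Hence (memo Theorem A) at layer one every pendant tree flattens into hairs at its attachment vertex by detach steps only; with
  `HairyCycle.SunFAR K 1` this gives FAR at layer one on every unicyclic support (assembly = file F-C).
[cite: Grimmett1999, §1.3 p. 10; §2.2] (product measure); [cite: KozmaNitzan2024, Conjecture 3 (p. 15)] (the rows served); [this work].
-/

noncomputable section

namespace Summit.CriticalPhenomena.PercolationContinuityZ3.Theorems

namespace Quant

namespace Bundle

open Finset MeasureTheory Set
open Literature.Probability.LatticeModels
open Literature.Probability.Percolation
open scoped Classical

variable {n : ℕ}

section Step

variable {o p u ℓ₁ : Fin n} {Lf : Finset (Fin n)} (H : IsPocket o p u ℓ₁ Lf) (w : Sym2 (Fin n) → unitInterval)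
  (hw0 : ∀ x y : Fin n, x ≠ y → (x ∈ insert u Lf ∨ y ∈ insert u Lf) → ¬ Allowed p u ℓ₁ Lf s(x, y) → (w s(x, y) : ℝ) = 0)
include H hw0

/-! ## Marginals are preserved -/

variable {A : Finset (Fin n)} (hLA : Lf ⊆ A) (huA : u ∉ A) (hb : (w s(p, ℓ₁) : ℝ) = 0)
  (hp1 : 0 < (w s(u, ℓ₁) : ℝ)) (hmax : ∀ ℓ ∈ Lf, (w s(u, ℓ) : ℝ) ≤ w s(u, ℓ₁))
include hLA huA hb hp1 hmax

omit hLA hp1 hmax in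
/-- DETACH preserves every relay marginal. [this work] -/
theorem real_openConn_wDet_eq {a : Fin n} (ha : a ∈ A) :
    (prodBernoulli (wDet p u ℓ₁ w)).real (openConn o a) = (prodBernoulli w).real (openConn o a) := by
  have hvD := wDet_vanish H w hw0
  by_cases haL : a ∈ Lf
  · rw [real_openConn_leaf_eq H _ hvD haL, real_openConn_leaf_eq H _ hw0 haL,
      real_offZ_event_eq_of_agree (wDet p u ℓ₁ w) w (insert u Lf) (fun e he => wDet_eq_of_avoid H w he) fun η => η ∈ openConn o p]
    congr 1
    by_cases ha1 : a = ℓ₁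
    · subst ha1
      rw [real_pocket_l1_of_c0 H _ (wDet_ul1 H w), real_pocket_of_b0 H _ hb H.l1, wDet_pl1 w]
    · have haI : a ∈ Lf.erase ℓ₁ := mem_erase.2 ⟨ha1, haL⟩
      rw [real_pocket_of_c0 H _ (wDet_ul1 H w) haI, real_pocket_of_b0 H _ hb haL, wDet_pu H w, wDet_ul H w haI]
  · have haZ : a ∉ insert u Lf := by
      rw [Finset.mem_insert, not_or]; exact ⟨fun h => huA (h ▸ ha), haL⟩
    rw [real_openConn_off_eq H _ hvD haZ, real_openConn_off_eq H _ hw0 haZ]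
    exact real_offZ_event_eq_of_agree _ _ _ (fun e he => wDet_eq_of_avoid H w he) fun η => η ∈ openConn o a

omit hLA in
/-- GLUE preserves every relay marginal. [this work] -/
theorem real_openConn_wGlue_eq {a : Fin n} (ha : a ∈ A) :
    (prodBernoulli (wGlue p u ℓ₁ Lf w)).real (openConn o a) = (prodBernoulli w).real (openConn o a) := by
  have hvG := wGlue_vanish H w hw0
  have hbG : (wGlue p u ℓ₁ Lf w s(p, ℓ₁) : ℝ) = 0 := by rw [wGlue_pl1 H w]; exact hb
  by_cases haL : a ∈ Lf
  · rw [real_openConn_leaf_eq H _ hvG haL, real_openConn_leaf_eq H _ hw0 haL,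
      real_offZ_event_eq_of_agree (wGlue p u ℓ₁ Lf w) w (insert u Lf) (fun e he => wGlue_eq_of_avoid w he) fun η => η ∈ openConn o p,
      real_pocket_of_b0 H _ hbG haL, real_pocket_of_b0 H _ hb haL, wGlue_pu w]
    congr 1
    by_cases ha1 : a = ℓ₁
    · subst ha1; rw [wGlue_ul1 H w]; ring
    · rw [wGlue_ul H w hmax hp1 (mem_erase.2 ⟨ha1, haL⟩)]
      field_simp
  · have haZ : a ∉ insert u Lf := by
      rw [Finset.mem_insert, not_or]; exact ⟨fun h => huA (h ▸ ha), haL⟩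
    rw [real_openConn_off_eq H _ hvG haZ, real_openConn_off_eq H _ hw0 haZ]
    exact real_offZ_event_eq_of_agree _ _ _ (fun e he => wGlue_eq_of_avoid w he) fun η => η ∈ openConn o a

/-! ## The expansion of `P(N ≥ 2)` for the three weight functions, and the dichotomy at graph level -/

/-- **(D) for `w`, `wDet`, `wGlue` with common coefficients**: there are `A₀` and `B, C ≥ 0` with
`P_w(N ≥ 2) = A₀ + B·hCur + C·tCur`, `P_wDet(N ≥ 2) = A₀ + B·hDet + C·tDet`, `P_wGlue(N ≥ 2) = A₀ + B·hGlue + C·tGlue`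
(the closed forms of `…QuantFarBundleDichotomy` at `a = w s(p,u)`, `p₁ = w s(u,ℓ₁)`, `I = Lf ∖ ℓ₁`, `q ℓ = w s(u,ℓ)`). [this work] -/
theorem real_two_le_expand :
    ∃ A₀ B C : ℝ, 0 ≤ B ∧ 0 ≤ C ∧
      (prodBernoulli w).real {ω : BondConfig (Fin n) | 2 ≤ (A.filter fun a => ω ∈ openConn o a).card} =
        A₀ + B * hCur (w s(p, u) : ℝ) (w s(u, ℓ₁) : ℝ) (Lf.erase ℓ₁) (fun ℓ => (w s(u, ℓ) : ℝ)) +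
          C * tCur (w s(p, u) : ℝ) (w s(u, ℓ₁) : ℝ) (Lf.erase ℓ₁) (fun ℓ => (w s(u, ℓ) : ℝ)) ∧
      (prodBernoulli (wDet p u ℓ₁ w)).real {ω : BondConfig (Fin n) | 2 ≤ (A.filter fun a => ω ∈ openConn o a).card} =
        A₀ + B * hDet (w s(p, u) : ℝ) (w s(u, ℓ₁) : ℝ) (Lf.erase ℓ₁) (fun ℓ => (w s(u, ℓ) : ℝ)) +
          C * tDet (w s(p, u) : ℝ) (w s(u, ℓ₁) : ℝ) (Lf.erase ℓ₁) (fun ℓ => (w s(u, ℓ) : ℝ)) ∧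
      (prodBernoulli (wGlue p u ℓ₁ Lf w)).real {ω : BondConfig (Fin n) | 2 ≤ (A.filter fun a => ω ∈ openConn o a).card} =
        A₀ + B * hGlue (w s(p, u) : ℝ) (w s(u, ℓ₁) : ℝ) +
          C * tGlue (w s(p, u) : ℝ) (w s(u, ℓ₁) : ℝ) (Lf.erase ℓ₁) (fun ℓ => (w s(u, ℓ) : ℝ)) := by
  have hvD := wDet_vanish H w hw0
  have hvG := wGlue_vanish H w hw0
  have hbG : (wGlue p u ℓ₁ Lf w s(p, ℓ₁) : ℝ) = 0 := by rw [wGlue_pl1 H w]; exact hb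
  set I := Lf.erase ℓ₁ with hI
  -- abbreviations for the pocket weights of `w`
  set a : ℝ := (w s(p, u) : ℝ) with ha
  set p₁ : ℝ := (w s(u, ℓ₁) : ℝ) with hp₁
  set q : Fin n → ℝ := fun ℓ => (w s(u, ℓ) : ℝ) with hq
  -- the coefficients `B = P(N_rest = 1, J)`, `C = P(N_rest = 0, J)` (the same for the three weight functions)
  set B : ℝ := (prodBernoulli w).real {ω | ((A \ Lf).filter fun a => offZ (insert u Lf) ω ∈ openConn o a).card = 1 ∧
      offZ (insert u Lf) ω ∈ openConn o p} with hB
  set C : ℝ := (prodBernoulli w).real {ω | ((A \ Lf).filter fun a => offZ (insert u Lf) ω ∈ openConn o a).card = 0 ∧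
      offZ (insert u Lf) ω ∈ openConn o p} with hC
  set A0 : ℝ := (prodBernoulli w).real {ω | 2 ≤ ((A \ Lf).filter fun a => offZ (insert u Lf) ω ∈ openConn o a).card} with hA0
  have hBn : 0 ≤ B := measureReal_nonneg
  have hCn : 0 ≤ C := measureReal_nonneg
  -- (D) for the three weight functions
  have hDw := real_two_le_card_eq H w hLA huA hw0
  have hDd := real_two_le_card_eq H (wDet p u ℓ₁ w) hLA huA hvD
  have hDg := real_two_le_card_eq H (wGlue p u ℓ₁ Lf w) hLA huA hvG
  -- coefficients agree
  have eA0d := real_offZ_event_eq_of_agree (wDet p u ℓ₁ w) w (insert u Lf) (fun e he => wDet_eq_of_avoid H w he)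
    fun η => 2 ≤ ((A \ Lf).filter fun a => η ∈ openConn o a).card
  have eBd := real_offZ_event_eq_of_agree (wDet p u ℓ₁ w) w (insert u Lf) (fun e he => wDet_eq_of_avoid H w he)
    fun η => ((A \ Lf).filter fun a => η ∈ openConn o a).card = 1 ∧ η ∈ openConn o p
  have eCd := real_offZ_event_eq_of_agree (wDet p u ℓ₁ w) w (insert u Lf) (fun e he => wDet_eq_of_avoid H w he)
    fun η => ((A \ Lf).filter fun a => η ∈ openConn o a).card = 0 ∧ η ∈ openConn o p
  have eA0g := real_offZ_event_eq_of_agree (wGlue p u ℓ₁ Lf w) w (insert u Lf) (fun e he => wGlue_eq_of_avoid w he)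
    fun η => 2 ≤ ((A \ Lf).filter fun a => η ∈ openConn o a).card
  have eBg := real_offZ_event_eq_of_agree (wGlue p u ℓ₁ Lf w) w (insert u Lf) (fun e he => wGlue_eq_of_avoid w he)
    fun η => ((A \ Lf).filter fun a => η ∈ openConn o a).card = 1 ∧ η ∈ openConn o p
  have eCg := real_offZ_event_eq_of_agree (wGlue p u ℓ₁ Lf w) w (insert u Lf) (fun e he => wGlue_eq_of_avoid w he)
    fun η => ((A \ Lf).filter fun a => η ∈ openConn o a).card = 0 ∧ η ∈ openConn o p
  -- pocket probabilities of `w`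
  have hX1w : (prodBernoulli w).real {ω : BondConfig (Fin n) | 1 ≤ (Lf.filter fun ℓ => pocket p u ℓ₁ ω ℓ).card} = hCur a p₁ I q := by
    rw [real_X1_of_b0 H w hb, z0_eq_mul_erase H.l1, ← hI]
    unfold hCur; ring
  have hX2w : (prodBernoulli w).real {ω : BondConfig (Fin n) | 2 ≤ (Lf.filter fun ℓ => pocket p u ℓ₁ ω ℓ).card} = tCur a p₁ I q := by
    rw [real_X2_of_b0 H w hb, z0_eq_mul_erase H.l1, z1_eq_erase H.l1, ← hI]
    unfold tCur; ring
  -- pocket probabilities of `wDet`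
  have hz0D : z0 I (fun ℓ => ((wDet p u ℓ₁ w) s(u, ℓ) : ℝ)) = z0 I q := by
    unfold z0
    exact prod_congr rfl fun ℓ hℓ => by simp only [hq, wDet_ul H w hℓ]
  have hz1D : z1 I (fun ℓ => ((wDet p u ℓ₁ w) s(u, ℓ) : ℝ)) = z1 I q := by
    unfold z1
    refine sum_congr rfl fun ℓ hℓ => ?_
    simp only [hq, wDet_ul H w hℓ]
    congr 1
    exact prod_congr rfl fun j hj => by rw [wDet_ul H w (mem_of_mem_erase hj)]
  have hX1d : (prodBernoulli (wDet p u ℓ₁ w)).real {ω : BondConfig (Fin n) | 1 ≤ (Lf.filter fun ℓ => pocket p u ℓ₁ ω ℓ).card} =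
      hDet a p₁ I q := by
    rw [real_X1_of_c0 H _ (wDet_ul1 H w), ← hI, hz0D, wDet_pl1 w, wDet_pu H w]
    unfold hDet; ring
  have hX2d : (prodBernoulli (wDet p u ℓ₁ w)).real {ω : BondConfig (Fin n) | 2 ≤ (Lf.filter fun ℓ => pocket p u ℓ₁ ω ℓ).card} =
      tDet a p₁ I q := by
    rw [real_X2_of_c0 H _ (wDet_ul1 H w), ← hI, hz0D, hz1D, wDet_pl1 w, wDet_pu H w]
    unfold tDet; ring
  -- pocket probabilities of `wGlue`
  have hqG : ∀ ℓ ∈ I, ((wGlue p u ℓ₁ Lf w) s(u, ℓ) : ℝ) = q ℓ / p₁ := fun ℓ hℓ => wGlue_ul H w hmax hp1 hℓ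
  have hz0G' : z0 I (fun ℓ => ((wGlue p u ℓ₁ Lf w) s(u, ℓ) : ℝ)) = z0 I (fun ℓ => q ℓ / p₁) := by
    unfold z0
    exact prod_congr rfl fun ℓ hℓ => by simp only [hqG ℓ hℓ]
  have hz0G : z0 Lf (fun ℓ => ((wGlue p u ℓ₁ Lf w) s(u, ℓ) : ℝ)) = 0 := by
    rw [z0_eq_mul_erase H.l1, wGlue_ul1 H w]; ring
  have hz1G : z1 Lf (fun ℓ => ((wGlue p u ℓ₁ Lf w) s(u, ℓ) : ℝ)) = z0 I (fun ℓ => q ℓ / p₁) := by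
    rw [z1_eq_erase H.l1, ← hI, hz0G', wGlue_ul1 H w]; ring
  have hX1g : (prodBernoulli (wGlue p u ℓ₁ Lf w)).real {ω : BondConfig (Fin n) | 1 ≤ (Lf.filter fun ℓ => pocket p u ℓ₁ ω ℓ).card} =
      hGlue a p₁ := by
    rw [real_X1_of_b0 H _ hbG, hz0G, wGlue_pu w]
    unfold hGlue; ring
  have hX2g : (prodBernoulli (wGlue p u ℓ₁ Lf w)).real {ω : BondConfig (Fin n) | 2 ≤ (Lf.filter fun ℓ => pocket p u ℓ₁ ω ℓ).card} =
      tGlue a p₁ I q := by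
    rw [real_X2_of_b0 H _ hbG, hz0G, hz1G, wGlue_pu w]
    unfold tGlue; ring
  refine ⟨A0, B, C, hBn, hCn, ?_, ?_, ?_⟩
  · rw [hDw, hX1w, hX2w]
  · rw [hDd, eA0d, eBd, eCd, hX1d, hX2d]
  · rw [hDg, eA0g, eBg, eCg, hX1g, hX2g]

/-- **DETACH or GLUE does not increase `P(N ≥ 2)`.** [this work] -/
theorem real_two_le_wDet_le_or_wGlue_le :
    (prodBernoulli (wDet p u ℓ₁ w)).real {ω : BondConfig (Fin n) | 2 ≤ (A.filter fun a => ω ∈ openConn o a).card} ≤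
        (prodBernoulli w).real {ω : BondConfig (Fin n) | 2 ≤ (A.filter fun a => ω ∈ openConn o a).card} ∨
      (prodBernoulli (wGlue p u ℓ₁ Lf w)).real {ω : BondConfig (Fin n) | 2 ≤ (A.filter fun a => ω ∈ openConn o a).card} ≤
        (prodBernoulli w).real {ω : BondConfig (Fin n) | 2 ≤ (A.filter fun a => ω ∈ openConn o a).card} := by
  obtain ⟨A₀, B, C, hBn, hCn, hw, hd, hg⟩ := real_two_le_expand H w hw0 hLA huA hb hp1 hmax
  have hq0 : ∀ i ∈ Lf.erase ℓ₁, 0 ≤ (fun ℓ => (w s(u, ℓ) : ℝ)) i := fun i _ => (w s(u, i)).2.1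
  have hqp : ∀ i ∈ Lf.erase ℓ₁, (fun ℓ => (w s(u, ℓ) : ℝ)) i ≤ (w s(u, ℓ₁) : ℝ) := fun i hi => hmax i (mem_of_mem_erase hi)
  rcases dichotomy (I := Lf.erase ℓ₁) (q := fun ℓ => (w s(u, ℓ) : ℝ)) hBn hCn (w s(p, u)).2.1 (w s(p, u)).2.2 hp1
      (w s(u, ℓ₁)).2.2 hq0 hqp with h | h
  · left; rw [hd, hw]; linarith
  · right; rw [hg, hw]; linarith

/-- **A single pendant leaf: DETACH is a law-preserving move** (`Lf = {ℓ₁}`): `P_wDet(N ≥ 2) = P_w(N ≥ 2)` (series reduction of the path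
`p – u – ℓ₁`). [this work] -/
theorem real_two_le_wDet_eq_of_single (hI : Lf.erase ℓ₁ = ∅) :
    (prodBernoulli (wDet p u ℓ₁ w)).real {ω : BondConfig (Fin n) | 2 ≤ (A.filter fun a => ω ∈ openConn o a).card} =
      (prodBernoulli w).real {ω : BondConfig (Fin n) | 2 ≤ (A.filter fun a => ω ∈ openConn o a).card} := by
  obtain ⟨A₀, B, C, -, -, hw, hd, -⟩ := real_two_le_expand H w hw0 hLA huA hb hp1 hmax
  have hid := det_sub_cur B C (w s(p, u) : ℝ) (w s(u, ℓ₁) : ℝ) (Lf.erase ℓ₁) (fun ℓ => (w s(u, ℓ) : ℝ))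
  rw [hI, z0_empty, z1_empty] at hid
  rw [hd, hw]
  rw [hI] at *
  linarith

/-! ## The exit inequality after GLUE and the transfer theorem -/

omit hLA huA hb hp1 hmax in
/-- After GLUE, reaching any other leaf `ℓ₂` forces two reached relays: `P_wGlue(o ↔ ℓ₂) ≤ P_wGlue(N ≥ 2)` (indeed `≤ P(J)·P(X ≥ 2)`).
[this work] -/
theorem real_openConn_le_two_le_wGlue (hLA : Lf ⊆ A) (huA : u ∉ A) (hb : (w s(p, ℓ₁) : ℝ) = 0) {ℓ₂ : Fin n} (hℓ₂ : ℓ₂ ∈ Lf.erase ℓ₁) :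
    (prodBernoulli (wGlue p u ℓ₁ Lf w)).real (openConn o ℓ₂) ≤
      (prodBernoulli (wGlue p u ℓ₁ Lf w)).real {ω : BondConfig (Fin n) | 2 ≤ (A.filter fun a => ω ∈ openConn o a).card} := by
  set v := wGlue p u ℓ₁ Lf w with hv
  have hvG := wGlue_vanish H w hw0
  have hbG : (v s(p, ℓ₁) : ℝ) = 0 := by rw [hv, wGlue_pl1 H w]; exact hb
  have hmeas : ∀ U : Set (BondConfig (Fin n)), MeasurableSet U := fun U => (Set.toFinite U).measurableSet
  have hℓ₂L : ℓ₂ ∈ Lf := mem_of_mem_erase hℓ₂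
  set J : Set (BondConfig (Fin n)) := {ω | offZ (insert u Lf) ω ∈ openConn o p} with hJ
  set X2 : Set (BondConfig (Fin n)) := {ω | 2 ≤ (Lf.filter fun ℓ => pocket p u ℓ₁ ω ℓ).card} with hX2
  -- `J ∩ {X ≥ 2} ⊆ {N ≥ 2}` almost surely
  have hsub : (prodBernoulli v).real (J ∩ X2) ≤ (prodBernoulli v).real {ω : BondConfig (Fin n) | 2 ≤ (A.filter fun a => ω ∈ openConn o a).card} := by
    have heq : (prodBernoulli v).real (J ∩ X2) =
        (prodBernoulli v).real (J ∩ X2 ∩ {ω : BondConfig (Fin n) | 2 ≤ (A.filter fun a => ω ∈ openConn o a).card}) := by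
      refine real_congr_of_good (p := p) (u := u) (ℓ₁ := ℓ₁) (Lf := Lf) v hvG _ _ fun ω hω => ?_
      simp only [Set.mem_inter_iff, mem_setOf_eq, hJ, hX2]
      constructor
      · rintro ⟨hj, hx⟩
        refine ⟨⟨hj, hx⟩, ?_⟩
        rw [card_filter_eq H hω hLA huA, if_pos hj]; omega
      · exact fun h => h.1
    rw [heq]; exact measureReal_mono Set.inter_subset_right
  -- `P(J ∩ X2) = P(J) P(X2)` and `P(X2) ≥ P(pocket ℓ₂)`
  have hind : (prodBernoulli v).real (J ∩ X2) = (prodBernoulli v).real J * (prodBernoulli v).real X2 :=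
    prodBernoulli_real_inter_of_determinedBy v (avoid (insert u Lf)) (determinedBy_offZ (insert u Lf) fun η => η ∈ openConn o p)
      (determinedBy_pocket H fun P => 2 ≤ (Lf.filter fun ℓ => P ℓ).card) (hmeas _) (hmeas _)
  have hv1 : (v s(u, ℓ₁) : ℝ) = 1 := by rw [hv]; exact wGlue_ul1 H w
  have hX2v : (prodBernoulli v).real X2 = (v s(p, u) : ℝ) * (1 - z0 (Lf.erase ℓ₁) fun ℓ => (v s(u, ℓ) : ℝ)) := by
    rw [hX2, real_X2_of_b0 H v hbG, z0_eq_mul_erase H.l1, z1_eq_erase H.l1, hv1]; ring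
  have hpk : (prodBernoulli v).real {ω : BondConfig (Fin n) | pocket p u ℓ₁ ω ℓ₂} = (v s(p, u) : ℝ) * (v s(u, ℓ₂) : ℝ) :=
    real_pocket_of_b0 H v hbG hℓ₂L
  -- `1 − z0 ≥ q ℓ₂`
  have hz : (v s(u, ℓ₂) : ℝ) ≤ 1 - z0 (Lf.erase ℓ₁) fun ℓ => (v s(u, ℓ) : ℝ) := by
    have hsplit : Lf.erase ℓ₁ = insert ℓ₂ ((Lf.erase ℓ₁).erase ℓ₂) := (insert_erase hℓ₂).symm
    rw [hsplit, z0_insert (notMem_erase ℓ₂ _)]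
    have h0 : 0 ≤ z0 ((Lf.erase ℓ₁).erase ℓ₂) (fun ℓ => (v s(u, ℓ) : ℝ)) := z0_nonneg fun i _ => (v s(u, i)).2.2
    have h1 : z0 ((Lf.erase ℓ₁).erase ℓ₂) (fun ℓ => (v s(u, ℓ) : ℝ)) ≤ 1 :=
      z0_le_one (fun i _ => (v s(u, i)).2.1) fun i _ => (v s(u, i)).2.2
    nlinarith [(v s(u, ℓ₂)).2.1, (v s(u, ℓ₂)).2.2]
  rw [real_openConn_leaf_eq H v hvG hℓ₂L, ← hJ, hpk]
  calc (prodBernoulli v).real J * ((v s(p, u) : ℝ) * (v s(u, ℓ₂) : ℝ))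
      ≤ (prodBernoulli v).real J * (prodBernoulli v).real X2 := by
        rw [hX2v]
        exact mul_le_mul_of_nonneg_left (mul_le_mul_of_nonneg_left hz (v s(p, u)).2.1) measureReal_nonneg
    _ = (prodBernoulli v).real (J ∩ X2) := hind.symm
    _ ≤ _ := hsub

/-- **THE TRANSFER** (memo Theorem A, one step): if every cut is at most `t` (`P_w(o ↮ a) ≤ t` on `A`) and the DETACHED configuration
satisfies the layer-one conclusion `P_wDet(N ≤ 1) ≤ t`, then so does `w`: `P_w(N ≤ 1) ≤ t`.  (DETACH branch: `P_w(N ≤ 1) ≤ P_wDet(N ≤ 1)`;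
GLUE branch: `P_w(N ≥ 2) ≥ P_wGlue(N ≥ 2) ≥ P(o ↔ ℓ₂) ≥ 1 − t`.) [this work] -/
theorem real_card_le_one_le_of_wDet (t : ℝ)
    (hcut : ∀ a ∈ A, (prodBernoulli w).real (openConn o a : Set (BondConfig (Fin n)))ᶜ ≤ t)
    (hdet : (prodBernoulli (wDet p u ℓ₁ w)).real {ω : BondConfig (Fin n) | (A.filter fun a => ω ∈ openConn o a).card ≤ 1} ≤ t) :
    (prodBernoulli w).real {ω : BondConfig (Fin n) | (A.filter fun a => ω ∈ openConn o a).card ≤ 1} ≤ t := by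
  have hmeas : ∀ (v : Sym2 (Fin n) → unitInterval) (U : Set (BondConfig (Fin n))), MeasurableSet U :=
    fun _ U => (Set.toFinite U).measurableSet
  -- complements
  have hcomp : ∀ v : Sym2 (Fin n) → unitInterval,
      (prodBernoulli v).real {ω : BondConfig (Fin n) | (A.filter fun a => ω ∈ openConn o a).card ≤ 1} =
        1 - (prodBernoulli v).real {ω : BondConfig (Fin n) | 2 ≤ (A.filter fun a => ω ∈ openConn o a).card} := by
    intro v
    have : {ω : BondConfig (Fin n) | (A.filter fun a => ω ∈ openConn o a).card ≤ 1} =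
        {ω : BondConfig (Fin n) | 2 ≤ (A.filter fun a => ω ∈ openConn o a).card}ᶜ := by
      ext ω; simp only [mem_setOf_eq, Set.mem_compl_iff]; omega
    rw [this, probReal_compl_eq_one_sub (hmeas v _)]
  rcases (Lf.erase ℓ₁).eq_empty_or_nonempty with hI | ⟨ℓ₂, hℓ₂⟩
  · -- a single leaf: DETACH preserves the law
    have h := real_two_le_wDet_eq_of_single H w hw0 hLA huA hb hp1 hmax hI
    rw [hcomp] at hdet ⊢
    linarith
  rcases real_two_le_wDet_le_or_wGlue_le H w hw0 hLA huA hb hp1 hmax with h | h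
  · -- DETACH branch
    rw [hcomp] at hdet ⊢
    linarith
  · -- GLUE branch: another leaf `ℓ₂`
    have hℓ₂A : ℓ₂ ∈ A := hLA (mem_of_mem_erase hℓ₂)
    have hexit := real_openConn_le_two_le_wGlue H w hw0 hLA huA hb hℓ₂
    rw [real_openConn_wGlue_eq H w hw0 huA hb hp1 hmax hℓ₂A] at hexit
    have hc := hcut ℓ₂ hℓ₂A
    rw [probReal_compl_eq_one_sub (hmeas w _)] at hc
    rw [hcomp]
    linarith

end Step

end Bundle

end Quant

end Summit.CriticalPhenomena.PercolationContinuityZ3.Theorems
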